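import Summits.Langlands.Langlands.Theorems.PhantomRMYoshidaResiduallyYoshidaLiftingKlingenDensityCornerVacuous
import Summits.Langlands.Langlands.Theorems.PhantomRMYoshidaResiduallyYoshidaLiftingGreenbergPlane
import Summits.Langlands.Langlands.Theorems.PhantomRMYoshidaResiduallyYoshidaLiftingGreenbergCocycleCore
import Summits.Langlands.Langlands.Theorems.PhantomRMYoshidaResiduallyYoshidaLiftingStablePlaneSaturation
import HarnessLib

/-!
# Route `PhantomRMYoshida`, crux `ResiduallyYoshidaLifting` (stmt-Langlands-13639), line `sector-klingen-split`:
# stub N1 `stub_realisedCocycleGreenberg` — the Greenberg (Selmer) condition AT `p` of a realised cocycle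

Stub-worker file of lead prover-line-stmt-Langlands-13639-c4-0 (skeleton rev 9, sub-goal N1 = census R1(b), local part;
companion of the landed "unramified away from `p`" bookkeeping `stub_realisedCocycleUnramified`).

**Theorem (`stub_realisedCocycleGreenberg`, registered signature verbatim).**  Let `ρ : Γ_ℚ → GL₄(ℚ̄_p)` be an
`Sh`-point (symplectic, Greenberg-ordinary of shape `(0,0,1,1)` at `v ∣ p`, …) realising the cocycle `B` through the
integral frame `(P, rint)` (`rint = P⁻¹ ρ P`, integral) with reduction conjugator `h`
(`red ∘ rint = h (σ̄, B; 0, σ̄') h⁻¹`), on a fibre with `det σ̄ = det σ̄' = ε̄⁻¹` (`DetC`), `p ≠ 2`.  Then inertia at `v`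
fixes some `x₁ ≠ 0` through `σ̄` and some `y₁ ≠ 0` through `σ̄'`, and after a coboundary change `B - δX₀` the cocycle
KILLS `y₁` on inertia: `(B τ - (σ̄ τ X₀ - X₀ σ̄' τ)) y₁ = 0` for `τ ∈ I_v`.

**Proof** (assembly of the landed N1a `stub_greenbergPlane`, T4 `stub_stablePlaneSaturation` and N1-core
`stub_greenbergCocycleCore`).
1. `Sh` at `v` gives `ρ|Γ_{ℚ_v}` Greenberg-ordinary of shape `(0,0,1,1)`, so (`stub_greenbergPlane`) a `Γ_{ℚ_v}`-stable
   plane `U ⊆ ℚ̄_p⁴` FIXED POINTWISE by inertia; `M₀` = matrix of a basis of `U` (`exists_basisMatrix_of_finrank_eq_two`),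
   `M₁ := P⁻¹ M₀` spans the corresponding plane for `rint`, stable under `Γ_{ℚ_v}` and fixed by `I_v`
   (`exists_integral_inertiaFixedPlane`).
2. Saturate over `ℤ̄_p` (`stub_stablePlaneSaturation`): an INTEGRAL `N = M₁ A` with an identity `2 × 2` block in rows
   `i ≠ j`; `rint(τ) N = N` for `τ ∈ I_v` by injectivity of `ℤ̄_p → ℚ̄_p` on matrices.
3. Reduce (`greenbergCocycle_of_fixed_identityRows`): `N̄ = red N` keeps the identity block (rank `2`),
   `h (σ̄, B; 0, σ̄') h⁻¹ N̄ = N̄` on inertia, so `N' := h⁻¹ N̄` transported to `k² ⊕ k²` along `finSumFinEquiv` is a rank-`2`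
   matrix fixed by the block matrices `(σ̄ τ, B τ; 0, σ̄' τ)`, `τ ∈ I_v`.
4. Inertia MOVES both constituents: the sibling crux's `exists_mem_absInertia_epsBar_ne_one` gives `τ₀ ∈ I_v` with
   `ε̄(τ₀) ≠ 1`, and `det σ̄(τ₀) = ε̄(τ₀)⁻¹ ≠ 1 = det 1` (`DetC`, `det_val_eq_of_det_eq`); likewise for `σ̄'`.
5. `stub_greenbergCocycleCore` over the index type `↥I_v`.

No new definitions, no named fact taken as a hypothesis; Mathlib + the four landed files above.
-/

noncomputable section

-- `Summit.Langlands.Langlands.…` (summit = sub-problem name, D-0017 layout) trips `dupNamespace` on every decl.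
set_option linter.dupNamespace false
set_option autoImplicit false

open IsDedekindDomain Filter
open scoped Matrix
open Literature.NumberTheory.GaloisRepresentations Literature.NumberTheory.Automorphic
open Summit.Langlands.Langlands.Cruxes.ResiduallyYoshidaLifting.YoshidaDivisorSelmerCount
open Summit.Langlands.Langlands.Cruxes.StableYoshidaCongruence.BurkhardtWeddleTwoThreeAnchor
  (exists_mem_absInertia_epsBar_ne_one det_val_eq_of_det_eq)

namespace Summit.Langlands.Langlands.Cruxes.ResiduallyYoshidaLifting.SectorKlingenSplit.Fibre

/-! ### A plane in matrix form, with its stabilisers and its pointwise fixers -/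

section BasisMatrix

variable {K : Type*} [Field K] {n : ℕ}

/-- A `2`-dimensional submodule `S ⊆ Kⁿ` in matrix form: the `n × 2` matrix `M` of a basis of `S` is injective on
`K²`, every matrix stabilising `S` acts on `M` through a `2 × 2` matrix (`R M = M T`), and every matrix fixing `S`
pointwise fixes `M` (`R M = M`). [folklore] -/
theorem exists_basisMatrix_of_finrank_eq_two (S : Submodule K (Fin n → K)) (h2 : Module.finrank K S = 2) :
    ∃ M : Matrix (Fin n) (Fin 2) K, (∀ a : Fin 2 → K, M *ᵥ a = 0 → a = 0) ∧
      (∀ R : Matrix (Fin n) (Fin n) K, (∀ u ∈ S, R *ᵥ u ∈ S) →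
        ∃ T : Matrix (Fin 2) (Fin 2) K, R * M = M * T) ∧
      ∀ R : Matrix (Fin n) (Fin n) K, (∀ u ∈ S, R *ᵥ u = u) → R * M = M := by
  -- adapted from `exists_stablePlane_of_stable_finrank_eq_two` (Theorems/…IrreducibleOfNoStableSubspace, p155087)
  let b : Module.Basis (Fin 2) K S := Module.finBasisOfFinrankEq K S h2
  let M : Matrix (Fin n) (Fin 2) K := Matrix.of fun i j => (b j : Fin n → K) i
  -- `M a` is the vector with coordinates `a` in the basis `b`
  have hMa : ∀ a : Fin 2 → K, M *ᵥ a = ((b.equivFun.symm a : S) : Fin n → K) := by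
    intro a
    rw [Module.Basis.equivFun_symm_apply, Submodule.coe_sum]
    funext i
    simp only [M, Matrix.mulVec, dotProduct, Matrix.of_apply, Finset.sum_apply, Submodule.coe_smul,
      Pi.smul_apply, smul_eq_mul, mul_comm]
  -- column `j` of `R M` is `R b_j`, column `j` of `M T` is `M T_{•j}`
  have hL : ∀ (R : Matrix (Fin n) (Fin n) K) (i : Fin n) (j : Fin 2),
      (R * M) i j = (R *ᵥ (b j : Fin n → K)) i := by
    intro R i j
    simp only [M, Matrix.mul_apply, Matrix.mulVec, dotProduct, Matrix.of_apply]
  have hR : ∀ (T : Matrix (Fin 2) (Fin 2) K) (i : Fin n) (j : Fin 2),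
      (M * T) i j = (M *ᵥ fun l => T l j) i := by
    intro T i j
    simp only [Matrix.mul_apply, Matrix.mulVec, dotProduct]
  refine ⟨M, fun a ha => ?_, fun R hRS => ?_, fun R hRS => ?_⟩
  · rw [hMa] at ha
    have h0 : b.equivFun.symm a = 0 := Subtype.ext ha
    exact (LinearEquiv.map_eq_zero_iff b.equivFun.symm).mp h0
  · refine ⟨Matrix.of fun l j => b.equivFun ⟨R *ᵥ (b j : Fin n → K), hRS _ (b j).2⟩ l, ?_⟩
    ext i j
    rw [hL, hR, hMa]
    simp only [Matrix.of_apply]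
    rw [LinearEquiv.symm_apply_apply]
  · ext i j
    rw [hL, hRS _ (b j).2]
    rfl

end BasisMatrix

/-! ### Steps 1–2: an integral inertia-fixed stable plane with an identity block -/

section Integral

variable {p : ℕ} [Fact p.Prime]

/-- **Steps 1–2.**  For `ρ_K : Γ_K → GL₄(ℚ̄_p)` Greenberg-ordinary of shape `(0,0,1,1)` (`K` a non-archimedean local
field) and an integral family `rint τ` with `rint τ = P⁻¹ ρ_K(τ) P` over `ℚ̄_p`, there is an INTEGRAL `N : ℤ̄_p⁴ˣ²` with
an identity `2 × 2` block in rows `i, j`, FIXED by inertia: `rint τ * N = N` for `τ ∈ I_K` (the Greenberg plane of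
`stub_greenbergPlane`, moved by `P⁻¹`, saturated by `stub_stablePlaneSaturation`). [folklore] -/
theorem exists_integral_inertiaFixedPlane
    {K : Type} [Field K] [ValuativeRel K] [TopologicalSpace K] [IsNonarchimedeanLocalField K]
    (ρK : FramedRep (Field.absoluteGaloisGroup K) (PadicAlgCl p) 4)
    (hGr : ρK.IsGreenbergOrdinaryOfShape ![0, 0, 1, 1]) (P : GL (Fin 4) (PadicAlgCl p))
    (rint : Field.absoluteGaloisGroup K → Matrix (Fin 4) (Fin 4) (Valued.integer (PadicAlgCl p)))
    (hP : ∀ τ, (rint τ).map (Valued.integer (PadicAlgCl p)).subtype = (P⁻¹).val * (ρK τ).val * P.val) :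
    ∃ (N : Matrix (Fin 4) (Fin 2) (Valued.integer (PadicAlgCl p))) (i j : Fin 4),
      N i 0 = 1 ∧ N i 1 = 0 ∧ N j 0 = 0 ∧ N j 1 = 1 ∧ ∀ τ ∈ absInertia K, rint τ * N = N := by
  obtain ⟨U, hU2, hUstab, hUfix⟩ := stub_greenbergPlane K p ρK hGr
  obtain ⟨M₀, hM₀inj, hM₀stab, hM₀fix⟩ := exists_basisMatrix_of_finrank_eq_two U hU2
  -- the plane `P⁻¹ U` of the integral frame: `M₁ := P⁻¹ M₀`
  obtain ⟨M₁, hM₁⟩ : ∃ M₁ : Matrix (Fin 4) (Fin 2) (PadicAlgCl p), M₁ = (P⁻¹).val * M₀ := ⟨_, rfl⟩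
  have hinj : ∀ a : Fin 2 → PadicAlgCl p, M₁ *ᵥ a = 0 → a = 0 := fun a ha => by
    apply hM₀inj
    calc M₀ *ᵥ a = P.val *ᵥ (M₁ *ᵥ a) := by
          rw [hM₁, Matrix.mulVec_mulVec, ← Matrix.mul_assoc, Units.mul_inv, Matrix.one_mul]
      _ = 0 := by rw [ha, Matrix.mulVec_zero]
  -- `rint τ = P⁻¹ ρ_K(τ) P` acts on `M₁` as `ρ_K(τ)` acts on `M₀`
  have hact : ∀ τ, (rint τ).map (Valued.integer (PadicAlgCl p)).subtype * M₁ = (P⁻¹).val * ((ρK τ).val * M₀) :=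
    fun τ => by
      rw [hP τ, hM₁, Matrix.mul_assoc, ← Matrix.mul_assoc P.val, Units.mul_inv, Matrix.one_mul, Matrix.mul_assoc]
  have hstab : ∀ τ, ∃ T : Matrix (Fin 2) (Fin 2) (PadicAlgCl p),
      (rint τ).map (Valued.integer (PadicAlgCl p)).subtype * M₁ = M₁ * T := fun τ => by
    obtain ⟨T, hT⟩ := hM₀stab (ρK τ).val (hUstab τ)
    exact ⟨T, by rw [hact τ, hT, hM₁, Matrix.mul_assoc]⟩
  have hfix : ∀ τ ∈ absInertia K, (rint τ).map (Valued.integer (PadicAlgCl p)).subtype * M₁ = M₁ :=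
    fun τ hτ => by rw [hact τ, hM₀fix _ (hUfix τ hτ), hM₁]
  -- saturation over `ℤ̄_p`
  obtain ⟨N, A, i, j, -, -, hNi0, hNi1, hNj0, hNj1, -, hNA, -⟩ :=
    stub_stablePlaneSaturation p (Field.absoluteGaloisGroup K) rint M₁ hinj hstab
  refine ⟨N, i, j, hNi0, hNi1, hNj0, hNj1, fun τ hτ => ?_⟩
  apply Matrix.map_injective (Valued.integer (PadicAlgCl p)).subtype_injective
  show (rint τ * N).map ⇑(Valued.integer (PadicAlgCl p)).subtype = N.map ⇑(Valued.integer (PadicAlgCl p)).subtype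
  rw [Matrix.map_mul, hNA, ← Matrix.mul_assoc, hfix τ hτ]

end Integral

/-! ### Step 3: reduction of an inertia-fixed integral plane with an identity block -/

section Residual

variable {O : Type*} [CommRing O] {k : Type} [Field k] {ι : Type}

/-- **Step 3 + N1-core.**  Let `N : O⁴ˣ²` carry an identity `2 × 2` block in rows `i, j` and be FIXED by a family
`R t` (`R t * N = N`) whose reductions through `red : O → k` are the realised block matrices
`h (S t, B t; 0, S' t) h⁻¹`, with some `S t₀ ≠ 1` and some `S' t₁ ≠ 1`.  Then `S` fixes some `x₁ ≠ 0`, `S'` fixes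
some `y₁ ≠ 0`, and for a suitable `X₀` the corrected cocycle kills `y₁`: `(B t - (S t X₀ - X₀ S' t)) y₁ = 0` for all
`t` (reduce `N`, conjugate by `h⁻¹`, transport along `finSumFinEquiv`, apply `stub_greenbergCocycleCore`). [folklore] -/
theorem greenbergCocycle_of_fixed_identityRows (red : O →+* k) (R : ι → Matrix (Fin 4) (Fin 4) O)
    (N : Matrix (Fin 4) (Fin 2) O) (i j : Fin 4)
    (hNi0 : N i 0 = 1) (hNi1 : N i 1 = 0) (hNj0 : N j 0 = 0) (hNj1 : N j 1 = 1)
    (hfix : ∀ t, R t * N = N) (h : GL (Fin 4) k) (S S' B : ι → Matrix (Fin 2) (Fin 2) k)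
    (hred : ∀ t, (R t).map red = h.val * Matrix.reindex finSumFinEquiv finSumFinEquiv
        (Matrix.fromBlocks (S t) (B t) 0 (S' t)) * (h⁻¹).val)
    (hS : ∃ t, S t ≠ 1) (hS' : ∃ t, S' t ≠ 1) :
    ∃ (X₀ : Matrix (Fin 2) (Fin 2) k) (x₁ y₁ : Fin 2 → k), x₁ ≠ 0 ∧ y₁ ≠ 0 ∧
      (∀ t, S t *ᵥ x₁ = x₁) ∧ (∀ t, S' t *ᵥ y₁ = y₁) ∧
      ∀ t, (B t - (S t * X₀ - X₀ * S' t)) *ᵥ y₁ = 0 := by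
  -- `red N` keeps the identity block, hence has rank `2`
  have hinj : ∀ a : Fin 2 → k, N.map red *ᵥ a = 0 → a = 0 := fun a ha => by
    have hi := congrFun ha i
    have hj := congrFun ha j
    simp only [Matrix.mulVec, dotProduct, Fin.sum_univ_two, Matrix.map_apply, hNi0, hNi1, hNj0, hNj1, map_one,
      map_zero, one_mul, zero_mul, add_zero, zero_add, Pi.zero_apply] at hi hj
    funext c
    fin_cases c
    · exact hi
    · exact hj
  -- the residual plane of `h⁻¹ (red N)` is fixed by the block matrices themselves
  have hN' : ∀ t, Matrix.reindex finSumFinEquiv finSumFinEquiv (Matrix.fromBlocks (S t) (B t) 0 (S' t)) *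
      ((h⁻¹).val * N.map red) = (h⁻¹).val * N.map red := fun t => by
    have e1 : (h⁻¹).val * (h.val * Matrix.reindex finSumFinEquiv finSumFinEquiv
        (Matrix.fromBlocks (S t) (B t) 0 (S' t)) * (h⁻¹).val * N.map red) = (h⁻¹).val * N.map red := by
      rw [← hred t, ← Matrix.map_mul, hfix t]
    simpa only [← Matrix.mul_assoc, Units.inv_mul, Matrix.one_mul] using e1
  -- transport along `finSumFinEquiv` to `N' : k^{(2 ⊕ 2) × 2}`; then `(S t, B t; 0, S' t) N' = N'`
  obtain ⟨N', hN'def⟩ : ∃ N' : Matrix (Fin 2 ⊕ Fin 2) (Fin 2) k,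
      N' = ((h⁻¹).val * N.map red).submatrix finSumFinEquiv id := ⟨_, rfl⟩
  have hfix' : ∀ t, Matrix.fromBlocks (S t) (B t) 0 (S' t) * N' = N' := fun t => by
    have e2 : (Matrix.reindex finSumFinEquiv finSumFinEquiv
        (Matrix.fromBlocks (S t) (B t) 0 (S' t))).submatrix finSumFinEquiv finSumFinEquiv =
        Matrix.fromBlocks (S t) (B t) 0 (S' t) := by
      rw [Matrix.reindex_apply, Matrix.submatrix_submatrix, Equiv.symm_comp_self, Matrix.submatrix_id_id]
    rw [← e2, hN'def, Matrix.submatrix_mul_equiv, hN' t]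
  -- `N'` has rank `2`
  have hN'mul : ∀ a : Fin 2 → k, N' *ᵥ a = (((h⁻¹).val * N.map red) *ᵥ a) ∘ finSumFinEquiv := fun a => by
    rw [hN'def]
    rfl
  have hinj' : ∀ a : Fin 2 → k, N' *ᵥ a = 0 → a = 0 := fun a ha => by
    have h1 : ((h⁻¹).val * N.map red) *ᵥ a = 0 := by
      funext l
      have e3 := congrFun ha (finSumFinEquiv.symm l)
      rw [hN'mul] at e3
      simpa only [Function.comp_apply, Equiv.apply_symm_apply, Pi.zero_apply] using e3
    apply hinj a
    calc N.map red *ᵥ a = h.val *ᵥ (((h⁻¹).val * N.map red) *ᵥ a) := by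
          rw [Matrix.mulVec_mulVec, ← Matrix.mul_assoc, Units.mul_inv, Matrix.one_mul]
      _ = 0 := by rw [h1, Matrix.mulVec_zero]
  exact stub_greenbergCocycleCore k ι S S' B N' hinj' hfix' hS hS'

end Residual

/-! ### Registered form -/

section Registered

/-- **Registered sub-goal N1 `stub_realisedCocycleGreenberg`** (crux stmt-Langlands-13639, line `sector-klingen-split`,
skeleton rev 9; census R1(b), local part): for an `Sh`-point `ρ` realising `B` through the integral frame `(P, rint)` with
reduction conjugator `h`, on a fibre with `det σ̄ = det σ̄' = ε̄⁻¹` (`DetC`; `p ≠ 2`), the realised cocycle is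
GREENBERG–SELMER AT `v ∣ p`: inertia at `v` fixes a line `k x₁` of `σ̄` and a line `k y₁` of `σ̄'`, and after a
coboundary change `B - δX₀` the cocycle kills `y₁` on inertia.  (Greenberg plane of `ρ|Γ_{ℚ_v}` in the frame, saturated
over `ℤ̄_p`, reduced, then `stub_greenbergCocycleCore` with the inertia element `ε̄(τ₀) ≠ 1` of
`exists_mem_absInertia_epsBar_ne_one`.) [folklore] -/
theorem stub_realisedCocycleGreenberg :
    ∀ (p : ℕ) [Fact p.Prime], p ≠ 2 → ∀ (k : Type) [Field k] [CharP k p] [IsAlgClosed k]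
      [TopologicalSpace k] [DiscreteTopology k] (red : Valued.integer (PadicAlgCl p) →+* k)
      (σ σ' : FramedGaloisRep ℚ k 2) (ρ : FramedGaloisRep ℚ (PadicAlgCl p) 4)
      (P : GL (Fin 4) (PadicAlgCl p))
      (rint : Field.absoluteGaloisGroup ℚ →* GL (Fin 4) (Valued.integer (PadicAlgCl p))) (h : GL (Fin 4) k)
      (B : Field.absoluteGaloisGroup ℚ → Matrix (Fin 2) (Fin 2) k)
      (v : HeightOneSpectrum (NumberField.RingOfIntegers ℚ)),
      ((p : ℕ) : NumberField.RingOfIntegers ℚ) ∈ v.asIdeal → DetC p k σ σ' → Sh p k red σ σ' ρ →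
      (∀ g, Matrix.GeneralLinearGroup.map (Valued.integer (PadicAlgCl p)).subtype (rint g) = P⁻¹ * ρ g * P) →
      (∀ g, (Matrix.GeneralLinearGroup.map red (rint g)).val =
          h.val * Matrix.reindex finSumFinEquiv finSumFinEquiv
            (Matrix.fromBlocks (σ g).val (B g) 0 (σ' g).val) * (h⁻¹).val) →
      ∃ (X₀ : Matrix (Fin 2) (Fin 2) k) (x₁ y₁ : Fin 2 → k), x₁ ≠ 0 ∧ y₁ ≠ 0 ∧
        (∀ τ ∈ absInertia (v.adicCompletion ℚ),
          (σ (absGaloisRestrict ℚ (v.adicCompletion ℚ) τ)).val *ᵥ x₁ = x₁) ∧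
        (∀ τ ∈ absInertia (v.adicCompletion ℚ),
          (σ' (absGaloisRestrict ℚ (v.adicCompletion ℚ) τ)).val *ᵥ y₁ = y₁) ∧
        ∀ τ ∈ absInertia (v.adicCompletion ℚ),
          (B (absGaloisRestrict ℚ (v.adicCompletion ℚ) τ) -
            ((σ (absGaloisRestrict ℚ (v.adicCompletion ℚ) τ)).val * X₀ -
              X₀ * (σ' (absGaloisRestrict ℚ (v.adicCompletion ℚ) τ)).val)) *ᵥ y₁ = 0 := by
  intro p _ hp k _ _ _ _ _ red σ σ' ρ P rint h B v hv hDet hSh hP hred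
  -- the integral frame over `ℚ̄_p` and over `k`, as plain matrix families
  have hPval : ∀ g, (rint g).val.map (Valued.integer (PadicAlgCl p)).subtype = (P⁻¹).val * (ρ g).val * P.val :=
    fun g => by
      have e := congrArg Units.val (hP g)
      rw [Units.val_mul, Units.val_mul] at e
      exact e
  have hredval : ∀ g, (rint g).val.map red = h.val * Matrix.reindex finSumFinEquiv finSumFinEquiv
      (Matrix.fromBlocks (σ g).val (B g) 0 (σ' g).val) * (h⁻¹).val := fun g => hred g
  -- Steps 1–2 for `ρ|Γ_{ℚ_v}` (Greenberg-ordinary of shape `(0,0,1,1)` by `Sh`)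
  have hGr : (ρ.toLocal v).IsGreenbergOrdinaryOfShape ![0, 0, 1, 1] := (hSh.2.1 v hv).1
  obtain ⟨N, i, j, hNi0, hNi1, hNj0, hNj1, hNfix⟩ :=
    exists_integral_inertiaFixedPlane (ρ.toLocal v) hGr P
      (fun τ => (rint (absGaloisRestrict ℚ (v.adicCompletion ℚ) τ)).val)
      (fun τ => hPval (absGaloisRestrict ℚ (v.adicCompletion ℚ) τ))
  -- Step 4: an inertia element `τ₀` with `ε̄(τ₀) ≠ 1` moves both constituents (`det = ε̄⁻¹`)
  obtain ⟨τ₀, hτ₀I, hτ₀⟩ := exists_mem_absInertia_epsBar_ne_one hp v hv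
  have hmove : ∀ s : FramedGaloisRep ℚ k 2,
      (∀ g, FramedRep.det s g = (Units.map (ZMod.castHom (dvd_refl p) k).toMonoidHom (εb p g))⁻¹) →
      (s (absGaloisRestrict ℚ (v.adicCompletion ℚ) τ₀)).val ≠ 1 := fun s hs h1 => by
    have h2 := det_val_eq_of_det_eq (hs (absGaloisRestrict ℚ (v.adicCompletion ℚ) τ₀))
    rw [h1, Matrix.det_one, eq_comm, map_eq_one_iff _ (ZMod.castHom_injective k), Units.val_eq_one,
      inv_eq_one] at h2
    exact hτ₀ h2
  -- Steps 3 + 5 over the index type `↥I_v`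
  obtain ⟨X₀, x₁, y₁, hx₁, hy₁, h1, h2, h3⟩ :=
    greenbergCocycle_of_fixed_identityRows red
      (fun t : absInertia (v.adicCompletion ℚ) => (rint (absGaloisRestrict ℚ (v.adicCompletion ℚ) t.1)).val)
      N i j hNi0 hNi1 hNj0 hNj1 (fun t => hNfix t.1 t.2) h
      (fun t => (σ (absGaloisRestrict ℚ (v.adicCompletion ℚ) t.1)).val)
      (fun t => (σ' (absGaloisRestrict ℚ (v.adicCompletion ℚ) t.1)).val)
      (fun t => B (absGaloisRestrict ℚ (v.adicCompletion ℚ) t.1))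
      (fun t => hredval _)
      ⟨⟨τ₀, hτ₀I⟩, hmove σ fun g => (hDet g).1⟩
      ⟨⟨τ₀, hτ₀I⟩, hmove σ' fun g => (hDet g).2.trans (hDet g).1⟩
  exact ⟨X₀, x₁, y₁, hx₁, hy₁, fun τ hτ => h1 ⟨τ, hτ⟩, fun τ hτ => h2 ⟨τ, hτ⟩, fun τ hτ => h3 ⟨τ, hτ⟩⟩

end Registered

end Summit.Langlands.Langlands.Cruxes.ResiduallyYoshidaLifting.SectorKlingenSplit.Fibre

end
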